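import Mathlib
import Summits.KontsevichZagierPeriods.Zeta5Search.Profile6cCellsA
import Summits.KontsevichZagierPeriods.Zeta5Search.Profile6cCellsB
import Summits.KontsevichZagierPeriods.Zeta5Search.Profile6dCellsA
import Summits.KontsevichZagierPeriods.Zeta5Search.Profile6dCellsB
import Summits.KontsevichZagierPeriods.Zeta5Search.DenomLaw.Profile15aPath
import Summits.KontsevichZagierPeriods.Zeta5Search.DenomLaw.PathWeightProfile
import Summits.KontsevichZagierPeriods.Zeta5Search.DenomLaw.LawZL5CoverKit
import Summits.KontsevichZagierPeriods.Zeta5Search.FlagRayDominance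
import Summits.KontsevichZagierPeriods.Zeta5Search.TopFamilyFPCasLB
import Summits.KontsevichZagierPeriods.Zeta5Search.DenomLaw.Profile11PathA
import HarnessLib

/-!
# ζ(5) search — the `N_p = 6` PROFILES 6c AND 6d of the first period for EVERY sorted parameter vector: PATH accounting at every depth (DENOM-LAW D1, prover-d1 gen 22)

Cell `pub-zeta5` (HONEST FRAMING: systematic search; no irrationality claim unless certified), TRACK «DENOM-LAW» D1 prover seat (denom-prover-d1
gen 22, `HOME/denom-law/prover-d1/ATTEMPT-22.md` §6).  Three of the four a = 7 profiles with exactly fifteen short pair blocks (`d < 2p` on each; THEOREM LB for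
every `d` via gen 22's `casLB_ge_of_cover_le0` at `⌊d/p⌋ = 0` and THEOREM LB with the single-pole row at `p ≤ d`): 6b short = all `(i,k)` with `k ≤ 6` (`C⋆ ≤ 7`, new
finite check `cStar_le_seven_6b`; `(−4,0)` / `(−4,1)`; node `−4 / −3`), 6c short = all `(i,k)` with `k ≤ 6` except `(5,6)`, and `(1,7)` (`C⋆ ≤ 8`, `cStar_le_eight_6c`;
`(−3,0)` / `(−3,1)`; node `−3 / −2`), 6d short = all `(1,k)`, `(2,k)`, and `(3,4),(3,5),(3,6),(4,5)` (`C⋆ ≤ 9`, `cStar_le_nine_6d`; `(−2,0)` / `(−2,1)`; node `−2 / −1`).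
The fourth (`(1,k),(2,k),(3,k)`) is NOT here: at `d < p` it needs the double drop WITHOUT `p ≤ d` (successor menu, with 7c).  Covers `FullProfile.cover6x_ev/od`
(`Profile6{b,c,d}Cells{A,B}`, machine-generated; every check `decide`).  Results: `pathAccounting_profile6x` (every `j`) and **`pathAccountingFirstPeriod_profile6x`**
(the node's binders VERBATIM plus `p ≤ b₇` and the profile inequalities; no depth hypothesis), x ∈ {c, d}.  Census beside the proof (gen 22, exhaustive a = 7 at
p = 7, 11, 3 % sample at p = 13): 6b 4,630 · 6c 1,120 · 6d 676 instances at p ≤ 13, every one reached by THEOREM LB; 0 open at p ≤ 13 (kit j285126).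
MODEL/structure-side valuation bookkeeping of the cell's own rationals; nothing about ζ(5); no γ; records in print UNMOVED.
-/

open Finset

namespace Summit.KontsevichZagierPeriods.Zeta5Search.FullProfile

open Summit.KontsevichZagierPeriods.Zeta5Search.ClusterValuation
open Summit.KontsevichZagierPeriods.Zeta5Search.CasoratianValuation (InPolytope shift casoratian pairFloors refund)
open Summit.KontsevichZagierPeriods.Zeta5Search.WedgeDictionary (dOf)
open Summit.KontsevichZagierPeriods.Zeta5Search.ClassTypeCover
open Summit.KontsevichZagierPeriods.Zeta5Search.DenomLaw (cStar FirstPeriod Sorted7 zeroClasses_of_cover zeroBound_of_classes zeroPointBound_of_classes cover_A3K cover_A4 cover_ZA rowsPal_of_cover)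
open Summit.KontsevichZagierPeriods.Zeta5Search.DenomLaw.FirstPeriodKit (cStar_le_eleven sorted7_chain firstPeriod_pair pairFloors_expand)
open Summit.KontsevichZagierPeriods.Zeta5Search.ZeroWindows (ZeroWindowClasses)
open Summit.KontsevichZagierPeriods.Zeta5Search.TopFamFP (cover_J_j)
open Summit.KontsevichZagierPeriods.Zeta5Search.StairFLAG (cover_B_j)
open Summit.KontsevichZagierPeriods.Zeta5Search.SortedProfile

/-! ## Path-weight bounds on 6c and 6d -/

/-- **`C⋆ ≤ 8` on 6c** (long blocks: `(i,7)` for `i ≥ 2`, and `(5,6)`). -/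
theorem cStar_le_eight_6c {b : ℕ → ℤ} {p : ℕ} (hs : Sorted7 b) (hQ : b 0 < (p : ℤ) + b 4 + b 6) (hQ17 : b 0 < (p : ℤ) + b 1 + b 7) : cStar b p ≤ 8 := by
  obtain ⟨h21, h32, h43, h54, h65, h76⟩ := sorted7_chain hs
  refine DenomLaw.FirstPeriodKit.cStar_le_of_profile (fun _ => True)
    (fun i k => ¬ (((i.val ≤ 5 ∧ k.val ≤ 5 ∧ ¬ (i.val = 4 ∧ k.val = 5) ∧ ¬ (i.val = 5 ∧ k.val = 4)) ∨ (i.val = 0 ∧ k.val = 6) ∨ (i.val = 6 ∧ k.val = 0)) ∧ i.val ≠ k.val)) 8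
    (fun _ _ => trivial) ?_ (by decide +kernel)
  intro i k hik h
  obtain ⟨h, hne⟩ := h
  have := i.isLt; have := k.isLt
  exfalso
  rcases h with ⟨hi, hk, hn1, hn2⟩ | ⟨hi, hk⟩ | ⟨hi, hk⟩ <;> interval_cases hv : i.val <;> interval_cases hw : k.val <;>
    simp only [Nat.reduceAdd] at hik <;> omega


/-- **`C⋆ ≤ 9` on 6d**. -/
theorem cStar_le_nine_6d {b : ℕ → ℤ} {p : ℕ} (hs : Sorted7 b) (hQ : b 0 < (p : ℤ) + b 2 + b 7) (hQ36 : b 0 < (p : ℤ) + b 3 + b 6) (hQ45 : b 0 < (p : ℤ) + b 4 + b 5) :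
    cStar b p ≤ 9 := by
  obtain ⟨h21, h32, h43, h54, h65, h76⟩ := sorted7_chain hs
  refine DenomLaw.FirstPeriodKit.cStar_le_of_profile (fun _ => True)
    (fun i k => ¬ (((i.val ≤ 1 ∨ k.val ≤ 1) ∨ (i.val = 2 ∧ k.val ≤ 5) ∨ (k.val = 2 ∧ i.val ≤ 5) ∨ (i.val = 3 ∧ k.val = 4) ∨ (i.val = 4 ∧ k.val = 3)) ∧ i.val ≠ k.val)) 9
    (fun _ _ => trivial) ?_ (by decide +kernel)
  intro i k hik h
  obtain ⟨h, hne⟩ := h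
  have := i.isLt; have := k.isLt
  exfalso
  rcases h with (hi | hk) | ⟨hi, hk⟩ | ⟨hk, hi⟩ | ⟨hi, hk⟩ | ⟨hi, hk⟩ <;> interval_cases hv : i.val <;> interval_cases hw : k.val <;>
    simp only [Nat.reduceAdd] at hik <;> omega


/-! ## The `N_p = 6` profile with short blocks `all (i,k) with k ≤ 6 except (5,6), and (1,7)` -/

section P6C

variable {b : ℕ → ℤ} {j p : ℕ}

/-- **`N_p = 6`** on this profile: the pair digits of the fifteen short blocks are `0`, the other six are `1`. -/
theorem pairFloors_eq_6c (hb : InPolytope b) (hs : Sorted7 b) (hp : 0 < p) (hQ : b 0 < (p : ℤ) + b 4 + b 6) (hQ17 : b 0 < (p : ℤ) + b 1 + b 7) (hQ27 : (p : ℤ) + b 2 + b 7 ≤ b 0) (hQ56 : (p : ℤ) + b 5 + b 6 ≤ b 0) (hfp : FirstPeriod b p) : pairFloors b p = 6 := by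
  obtain ⟨h21, h32, h43, h54, h65, h76⟩ := sorted7_chain hs
  obtain ⟨h0, hb1, hb2, hb3, hb4, hb5, hb6, hb7, hc1⟩ := box hb
  have hp0 : (0 : ℤ) < p := by exact_mod_cast hp
  have one : ∀ z : ℤ, (p : ℤ) ≤ z → z ≤ 2 * (p : ℤ) - 1 → z / (p : ℤ) = 1 := fun z h1 h2 => by
    rw [Int.ediv_eq_iff_of_pos hp0]; constructor <;> linarith
  have z12 : (b 0 - b 1 - b 2) / (p : ℤ) = 0 := Int.ediv_eq_zero_of_lt (by linarith) (by linarith)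
  have z13 : (b 0 - b 1 - b 3) / (p : ℤ) = 0 := Int.ediv_eq_zero_of_lt (by linarith) (by linarith)
  have z14 : (b 0 - b 1 - b 4) / (p : ℤ) = 0 := Int.ediv_eq_zero_of_lt (by linarith) (by linarith)
  have z15 : (b 0 - b 1 - b 5) / (p : ℤ) = 0 := Int.ediv_eq_zero_of_lt (by linarith) (by linarith)
  have z16 : (b 0 - b 1 - b 6) / (p : ℤ) = 0 := Int.ediv_eq_zero_of_lt (by linarith) (by linarith)
  have z17 : (b 0 - b 1 - b 7) / (p : ℤ) = 0 := Int.ediv_eq_zero_of_lt (by linarith) (by linarith)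
  have z23 : (b 0 - b 2 - b 3) / (p : ℤ) = 0 := Int.ediv_eq_zero_of_lt (by linarith) (by linarith)
  have z24 : (b 0 - b 2 - b 4) / (p : ℤ) = 0 := Int.ediv_eq_zero_of_lt (by linarith) (by linarith)
  have z25 : (b 0 - b 2 - b 5) / (p : ℤ) = 0 := Int.ediv_eq_zero_of_lt (by linarith) (by linarith)
  have z26 : (b 0 - b 2 - b 6) / (p : ℤ) = 0 := Int.ediv_eq_zero_of_lt (by linarith) (by linarith)
  have z34 : (b 0 - b 3 - b 4) / (p : ℤ) = 0 := Int.ediv_eq_zero_of_lt (by linarith) (by linarith)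
  have z35 : (b 0 - b 3 - b 5) / (p : ℤ) = 0 := Int.ediv_eq_zero_of_lt (by linarith) (by linarith)
  have z36 : (b 0 - b 3 - b 6) / (p : ℤ) = 0 := Int.ediv_eq_zero_of_lt (by linarith) (by linarith)
  have z45 : (b 0 - b 4 - b 5) / (p : ℤ) = 0 := Int.ediv_eq_zero_of_lt (by linarith) (by linarith)
  have z46 : (b 0 - b 4 - b 6) / (p : ℤ) = 0 := Int.ediv_eq_zero_of_lt (by linarith) (by linarith)
  have U := fun (i k : ℕ) (hi : i < 7) (hk : k < 7) (hik : i < k) => firstPeriod_pair hfp hi hk hik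
  rw [pairFloors_expand, z12, z13, z14, z15, z16, z17, z23, z24, z25, z26, z34, z35, z36, z45, z46,
    one _ (by linarith) (U 1 6 (by norm_num) (by norm_num) (by norm_num)),
    one _ (by linarith) (U 2 6 (by norm_num) (by norm_num) (by norm_num)),
    one _ (by linarith) (U 3 6 (by norm_num) (by norm_num) (by norm_num)),
    one _ (by linarith) (U 4 5 (by norm_num) (by norm_num) (by norm_num)),
    one _ (by linarith) (U 4 6 (by norm_num) (by norm_num) (by norm_num)),
    one _ (by linarith) (U 5 6 (by norm_num) (by norm_num) (by norm_num))]
  norm_num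

/-- **THEOREM LB on this profile, general `b`, any depth**: `v_p(Cas_j(b)) ≥ -3` (`(A, B) = (-3, 0)`, `B ≤ 0`; gen 22's `casLB_ge_of_cover_le0`). -/
theorem cas_ge6c_neg3 (hb : InPolytope b) (hs : Sorted7 b) (hbj : InPolytope (shift b j)) (hj1 : 1 ≤ j) (hj7 : j ≤ 7)
    (hprime : p.Prime) (hp5 : 5 ≤ p) (hwin : (b 0 + 2 : ℤ) < (p : ℤ) ^ 2) (hP : (p : ℤ) ≤ b 7) (hQ : b 0 < (p : ℤ) + b 4 + b 6) (hQ17 : b 0 < (p : ℤ) + b 1 + b 7) (hQ27 : (p : ℤ) + b 2 + b 7 ≤ b 0) (hQ56 : (p : ℤ) + b 5 + b 6 ≤ b 0)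
    (hF1 : b 1 < 2 * (p : ℤ)) (hF2 : b 0 < 2 * (p : ℤ) + b 6 + b 7) (hcas : casoratian b j ≠ 0) : (-3 : ℤ) ≤ padicValRat p (casoratian b j) := by
  haveI : Fact p.Prime := ⟨hprime⟩
  have hp2 : p % 2 = 1 := Nat.odd_iff.1 (hprime.odd_of_ne_two (by omega))
  have hv := casoratianClassBound_holds b j p hb hj1 hj7 hbj hprime hp5 hwin hcas
  rcases Int.emod_two_eq_zero_or_one (b 0) with hr | hr
  · rcases casLB_ge_of_cover_le0 (cover6c_ev hb hs hP hQ hQ17 hQ27 hQ56 hF1 hF2 hp5 hp2 hr) (A := -3) (B := 0) (by rw [oddFlag_false hr]; decide) (by norm_num) with h0 | h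
    · rw [h0] at hv; linarith
    · linarith
  · rcases casLB_ge_of_cover_le0 (cover6c_od hb hs hP hQ hQ17 hQ27 hQ56 hF1 hF2 hp5 hp2 hr) (A := -3) (B := 0) (by rw [oddFlag_true hr]; decide) (by norm_num) with h0 | h
    · rw [h0] at hv; linarith
    · linarith

/-- **THEOREM LB on this profile, general `b`**: `v_p(Cas_j(b)) ≥ VB + row = casLB` from a spelled-out `checkLB` on both covers. -/
theorem cas_ge6c_neg2 (hb : InPolytope b) (hs : Sorted7 b) (hbj : InPolytope (shift b j)) (hj1 : 1 ≤ j) (hj7 : j ≤ 7)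
    (hprime : p.Prime) (hp5 : 5 ≤ p) (hwin : (b 0 + 2 : ℤ) < (p : ℤ) ^ 2) (hP : (p : ℤ) ≤ b 7) (hQ : b 0 < (p : ℤ) + b 4 + b 6) (hQ17 : b 0 < (p : ℤ) + b 1 + b 7) (hQ27 : (p : ℤ) + b 2 + b 7 ≤ b 0) (hQ56 : (p : ℤ) + b 5 + b 6 ≤ b 0)
    (hF1 : b 1 < 2 * (p : ℤ)) (hF2 : b 0 < 2 * (p : ℤ) + b 6 + b 7) (hpd : (p : ℤ) ≤ dOf b) (hcas : casoratian b j ≠ 0) : (-2 : ℤ) ≤ padicValRat p (casoratian b j) := by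
  haveI : Fact p.Prime := ⟨hprime⟩
  have hp2 : p % 2 = 1 := Nat.odd_iff.1 (hprime.odd_of_ne_two (by omega))
  obtain ⟨h21, h32, h43, h54, h65, h76⟩ := sorted7_chain hs
  obtain ⟨h0, hb1, hb2, hb3, hb4, hb5, hb6, hb7, hc1⟩ := box hb
  have hv := casoratianClassBound_holds b j p hb hj1 hj7 hbj hprime hp5 hwin hcas
  rcases Int.emod_two_eq_zero_or_one (b 0) with hr | hr
  · rcases casLB_ge_of_cover (cover6c_ev hb hs hP hQ hQ17 hQ27 hQ56 hF1 hF2 hp5 hp2 hr) (A := -3) (B := 1)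
        (by rw [oddFlag_false hr]; decide) (by norm_num) hpd with h0 | h
    · rw [h0] at hv; linarith
    · linarith
  · rcases casLB_ge_of_cover (cover6c_od hb hs hP hQ hQ17 hQ27 hQ56 hF1 hF2 hp5 hp2 hr) (A := -3) (B := 1)
        (by rw [oddFlag_true hr]; decide) (by norm_num) hpd with h0 | h
    · rw [h0] at hv; linarith
    · linarith

/-- On this profile `d(b) < 2p`. -/
theorem d_lt_two6c (hs : Sorted7 b) (hP : (p : ℤ) ≤ b 7) (_hQ : b 0 < (p : ℤ) + b 4 + b 6) (_hQ17 : b 0 < (p : ℤ) + b 1 + b 7) (_hQ27 : (p : ℤ) + b 2 + b 7 ≤ b 0) (_hQ56 : (p : ℤ) + b 5 + b 6 ≤ b 0) : dOf b < 2 * (p : ℤ) := by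
  obtain ⟨h21, h32, h43, h54, h65, h76⟩ := sorted7_chain hs
  rw [DecompositionWholeCone.dOf_expand]; linarith

/-- **`PathAccountingFirstPeriod`'s conclusion on this `N_p = 6` profile (short blocks `all (i,k) with k ≤ 6 except (5,6), and (1,7)`), EVERY sorted `b`, every direction `j`, every depth**
(`C⋆ ≤ 8`; `d < 2p`; the node asks `-3` at `⌊d/p⌋ = 0` and `-2` at `⌊d/p⌋ = 1`). -/
theorem pathAccounting_profile6c (b : ℕ → ℤ) (j p : ℕ) (hb : InPolytope b) (hs : Sorted7 b) (hbj : InPolytope (shift b j))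
    (hj1 : 1 ≤ j) (hj7 : j ≤ 7) (hprime : p.Prime) (hp5 : 5 ≤ p) (hwin : (b 0 + 2 : ℤ) < (p : ℤ) ^ 2) (hfp : FirstPeriod b p)
    (hP : (p : ℤ) ≤ b 7) (hQ : b 0 < (p : ℤ) + b 4 + b 6) (hQ17 : b 0 < (p : ℤ) + b 1 + b 7) (hQ27 : (p : ℤ) + b 2 + b 7 ≤ b 0) (hQ56 : (p : ℤ) + b 5 + b 6 ≤ b 0)
    (hcas : casoratian b j ≠ 0) :
    dOf b / (p : ℤ) - pairFloors b p - min (if 2 ≤ dOf b / (p : ℤ) then (1 : ℤ) else 0) (5 - (cStar b p : ℤ))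
      ≤ padicValRat p (casoratian b j) := by
  obtain ⟨hF1, hF2⟩ := fp_bounds hfp
  have hp0 : (0 : ℤ) < p := by exact_mod_cast hprime.pos
  rw [pairFloors_eq_6c hb hs hprime.pos hQ hQ17 hQ27 hQ56 hfp]
  have hC8 : (cStar b p : ℤ) ≤ 8 := by exact_mod_cast cStar_le_eight_6c hs hQ hQ17
  have hfd : dOf b / (p : ℤ) < 2 := by rw [Int.ediv_lt_iff_lt_mul hp0]; linarith [d_lt_two6c hs hP hQ hQ17 hQ27 hQ56]
  rw [if_neg (by omega)]
  have hmin : -3 ≤ min (0 : ℤ) (5 - (cStar b p : ℤ)) := le_min (by norm_num) (by linarith)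
  by_cases h1 : (p : ℤ) ≤ dOf b
  · linarith [cas_ge6c_neg2 hb hs hbj hj1 hj7 hprime hp5 hwin hP hQ hQ17 hQ27 hQ56 hF1 hF2 h1 hcas]
  · push Not at h1
    obtain ⟨h21, h32, h43, h54, h65, h76⟩ := sorted7_chain hs
    have hsum := hb.2.2
    simp only [Finset.sum_range_succ, Finset.sum_range_zero, zero_add, Nat.reduceAdd] at hsum
    have hd0 : 0 ≤ dOf b := by rw [DecompositionWholeCone.dOf_expand]; linarith
    have hfd0 : dOf b / (p : ℤ) = 0 := Int.ediv_eq_zero_of_lt hd0 h1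
    rw [hfd0]
    linarith [cas_ge6c_neg3 hb hs hbj hj1 hj7 hprime hp5 hwin hP hQ hQ17 hQ27 hQ56 hF1 hF2 hcas]

/-- **THE NODE ON THIS `N_p = 6` PROFILE, EVERY SORTED `b`, EVERY DEPTH: `PathAccountingFirstPeriod` with its binders VERBATIM plus `p ≤ b₇` and the profile
inequalities.** -/
theorem pathAccountingFirstPeriod_profile6c :
    ∀ (b : ℕ → ℤ) (p : ℕ), InPolytope b → Sorted7 b → InPolytope (shift b 7) →
      p.Prime → 5 ≤ p → (b 0 + 2 : ℤ) < (p : ℤ) ^ 2 → FirstPeriod b p →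
      (p : ℤ) ≤ b 7 → b 0 < (p : ℤ) + b 4 + b 6 → b 0 < (p : ℤ) + b 1 + b 7 → (p : ℤ) + b 2 + b 7 ≤ b 0 → (p : ℤ) + b 5 + b 6 ≤ b 0 → casoratian b 7 ≠ 0 →
        dOf b / (p : ℤ) - pairFloors b p - min (if 2 ≤ dOf b / (p : ℤ) then (1 : ℤ) else 0) (5 - (cStar b p : ℤ))
          ≤ padicValRat p (casoratian b 7) :=
  fun b p hb hs hb7 hprime hp5 hwin hfp hP hQ hQ17 hQ27 hQ56 hcas =>
    pathAccounting_profile6c b 7 p hb hs hb7 (by norm_num) (by norm_num) hprime hp5 hwin hfp hP hQ hQ17 hQ27 hQ56 hcas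

end P6C

/-! ## The `N_p = 6` profile with short blocks `all (1,k), (2,k), and (3,4),(3,5),(3,6),(4,5)` -/

section P6D

variable {b : ℕ → ℤ} {j p : ℕ}

/-- **`N_p = 6`** on this profile: the pair digits of the fifteen short blocks are `0`, the other six are `1`. -/
theorem pairFloors_eq_6d (hb : InPolytope b) (hs : Sorted7 b) (hp : 0 < p) (hQ : b 0 < (p : ℤ) + b 2 + b 7) (hQ36 : b 0 < (p : ℤ) + b 3 + b 6) (hQ45 : b 0 < (p : ℤ) + b 4 + b 5) (hQ37 : (p : ℤ) + b 3 + b 7 ≤ b 0) (hQ46 : (p : ℤ) + b 4 + b 6 ≤ b 0) (hfp : FirstPeriod b p) : pairFloors b p = 6 := by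
  obtain ⟨h21, h32, h43, h54, h65, h76⟩ := sorted7_chain hs
  obtain ⟨h0, hb1, hb2, hb3, hb4, hb5, hb6, hb7, hc1⟩ := box hb
  have hp0 : (0 : ℤ) < p := by exact_mod_cast hp
  have one : ∀ z : ℤ, (p : ℤ) ≤ z → z ≤ 2 * (p : ℤ) - 1 → z / (p : ℤ) = 1 := fun z h1 h2 => by
    rw [Int.ediv_eq_iff_of_pos hp0]; constructor <;> linarith
  have z12 : (b 0 - b 1 - b 2) / (p : ℤ) = 0 := Int.ediv_eq_zero_of_lt (by linarith) (by linarith)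
  have z13 : (b 0 - b 1 - b 3) / (p : ℤ) = 0 := Int.ediv_eq_zero_of_lt (by linarith) (by linarith)
  have z14 : (b 0 - b 1 - b 4) / (p : ℤ) = 0 := Int.ediv_eq_zero_of_lt (by linarith) (by linarith)
  have z15 : (b 0 - b 1 - b 5) / (p : ℤ) = 0 := Int.ediv_eq_zero_of_lt (by linarith) (by linarith)
  have z16 : (b 0 - b 1 - b 6) / (p : ℤ) = 0 := Int.ediv_eq_zero_of_lt (by linarith) (by linarith)
  have z17 : (b 0 - b 1 - b 7) / (p : ℤ) = 0 := Int.ediv_eq_zero_of_lt (by linarith) (by linarith)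
  have z23 : (b 0 - b 2 - b 3) / (p : ℤ) = 0 := Int.ediv_eq_zero_of_lt (by linarith) (by linarith)
  have z24 : (b 0 - b 2 - b 4) / (p : ℤ) = 0 := Int.ediv_eq_zero_of_lt (by linarith) (by linarith)
  have z25 : (b 0 - b 2 - b 5) / (p : ℤ) = 0 := Int.ediv_eq_zero_of_lt (by linarith) (by linarith)
  have z26 : (b 0 - b 2 - b 6) / (p : ℤ) = 0 := Int.ediv_eq_zero_of_lt (by linarith) (by linarith)
  have z27 : (b 0 - b 2 - b 7) / (p : ℤ) = 0 := Int.ediv_eq_zero_of_lt (by linarith) (by linarith)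
  have z34 : (b 0 - b 3 - b 4) / (p : ℤ) = 0 := Int.ediv_eq_zero_of_lt (by linarith) (by linarith)
  have z35 : (b 0 - b 3 - b 5) / (p : ℤ) = 0 := Int.ediv_eq_zero_of_lt (by linarith) (by linarith)
  have z36 : (b 0 - b 3 - b 6) / (p : ℤ) = 0 := Int.ediv_eq_zero_of_lt (by linarith) (by linarith)
  have z45 : (b 0 - b 4 - b 5) / (p : ℤ) = 0 := Int.ediv_eq_zero_of_lt (by linarith) (by linarith)
  have U := fun (i k : ℕ) (hi : i < 7) (hk : k < 7) (hik : i < k) => firstPeriod_pair hfp hi hk hik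
  rw [pairFloors_expand, z12, z13, z14, z15, z16, z17, z23, z24, z25, z26, z27, z34, z35, z36, z45,
    one _ (by linarith) (U 2 6 (by norm_num) (by norm_num) (by norm_num)),
    one _ (by linarith) (U 3 5 (by norm_num) (by norm_num) (by norm_num)),
    one _ (by linarith) (U 3 6 (by norm_num) (by norm_num) (by norm_num)),
    one _ (by linarith) (U 4 5 (by norm_num) (by norm_num) (by norm_num)),
    one _ (by linarith) (U 4 6 (by norm_num) (by norm_num) (by norm_num)),
    one _ (by linarith) (U 5 6 (by norm_num) (by norm_num) (by norm_num))]
  norm_num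

/-- **THEOREM LB on this profile, general `b`, any depth**: `v_p(Cas_j(b)) ≥ -2` (`(A, B) = (-2, 0)`, `B ≤ 0`; gen 22's `casLB_ge_of_cover_le0`). -/
theorem cas_ge6d_neg2 (hb : InPolytope b) (hs : Sorted7 b) (hbj : InPolytope (shift b j)) (hj1 : 1 ≤ j) (hj7 : j ≤ 7)
    (hprime : p.Prime) (hp5 : 5 ≤ p) (hwin : (b 0 + 2 : ℤ) < (p : ℤ) ^ 2) (hP : (p : ℤ) ≤ b 7) (hQ : b 0 < (p : ℤ) + b 2 + b 7) (hQ36 : b 0 < (p : ℤ) + b 3 + b 6) (hQ45 : b 0 < (p : ℤ) + b 4 + b 5) (hQ37 : (p : ℤ) + b 3 + b 7 ≤ b 0) (hQ46 : (p : ℤ) + b 4 + b 6 ≤ b 0)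
    (hF1 : b 1 < 2 * (p : ℤ)) (hF2 : b 0 < 2 * (p : ℤ) + b 6 + b 7) (hcas : casoratian b j ≠ 0) : (-2 : ℤ) ≤ padicValRat p (casoratian b j) := by
  haveI : Fact p.Prime := ⟨hprime⟩
  have hp2 : p % 2 = 1 := Nat.odd_iff.1 (hprime.odd_of_ne_two (by omega))
  have hv := casoratianClassBound_holds b j p hb hj1 hj7 hbj hprime hp5 hwin hcas
  rcases Int.emod_two_eq_zero_or_one (b 0) with hr | hr
  · rcases casLB_ge_of_cover_le0 (cover6d_ev hb hs hP hQ hQ36 hQ45 hQ37 hQ46 hF1 hF2 hp5 hp2 hr) (A := -2) (B := 0) (by rw [oddFlag_false hr]; decide) (by norm_num) with h0 | h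
    · rw [h0] at hv; linarith
    · linarith
  · rcases casLB_ge_of_cover_le0 (cover6d_od hb hs hP hQ hQ36 hQ45 hQ37 hQ46 hF1 hF2 hp5 hp2 hr) (A := -2) (B := 0) (by rw [oddFlag_true hr]; decide) (by norm_num) with h0 | h
    · rw [h0] at hv; linarith
    · linarith

/-- **THEOREM LB on this profile, general `b`**: `v_p(Cas_j(b)) ≥ VB + row = casLB` from a spelled-out `checkLB` on both covers. -/
theorem cas_ge6d_neg1 (hb : InPolytope b) (hs : Sorted7 b) (hbj : InPolytope (shift b j)) (hj1 : 1 ≤ j) (hj7 : j ≤ 7)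
    (hprime : p.Prime) (hp5 : 5 ≤ p) (hwin : (b 0 + 2 : ℤ) < (p : ℤ) ^ 2) (hP : (p : ℤ) ≤ b 7) (hQ : b 0 < (p : ℤ) + b 2 + b 7) (hQ36 : b 0 < (p : ℤ) + b 3 + b 6) (hQ45 : b 0 < (p : ℤ) + b 4 + b 5) (hQ37 : (p : ℤ) + b 3 + b 7 ≤ b 0) (hQ46 : (p : ℤ) + b 4 + b 6 ≤ b 0)
    (hF1 : b 1 < 2 * (p : ℤ)) (hF2 : b 0 < 2 * (p : ℤ) + b 6 + b 7) (hpd : (p : ℤ) ≤ dOf b) (hcas : casoratian b j ≠ 0) : (-1 : ℤ) ≤ padicValRat p (casoratian b j) := by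
  haveI : Fact p.Prime := ⟨hprime⟩
  have hp2 : p % 2 = 1 := Nat.odd_iff.1 (hprime.odd_of_ne_two (by omega))
  obtain ⟨h21, h32, h43, h54, h65, h76⟩ := sorted7_chain hs
  obtain ⟨h0, hb1, hb2, hb3, hb4, hb5, hb6, hb7, hc1⟩ := box hb
  have hv := casoratianClassBound_holds b j p hb hj1 hj7 hbj hprime hp5 hwin hcas
  rcases Int.emod_two_eq_zero_or_one (b 0) with hr | hr
  · rcases casLB_ge_of_cover (cover6d_ev hb hs hP hQ hQ36 hQ45 hQ37 hQ46 hF1 hF2 hp5 hp2 hr) (A := -2) (B := 1)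
        (by rw [oddFlag_false hr]; decide) (by norm_num) hpd with h0 | h
    · rw [h0] at hv; linarith
    · linarith
  · rcases casLB_ge_of_cover (cover6d_od hb hs hP hQ hQ36 hQ45 hQ37 hQ46 hF1 hF2 hp5 hp2 hr) (A := -2) (B := 1)
        (by rw [oddFlag_true hr]; decide) (by norm_num) hpd with h0 | h
    · rw [h0] at hv; linarith
    · linarith

/-- On this profile `d(b) < 2p`. -/
theorem d_lt_two6d (hs : Sorted7 b) (hP : (p : ℤ) ≤ b 7) (_hQ : b 0 < (p : ℤ) + b 2 + b 7) (_hQ36 : b 0 < (p : ℤ) + b 3 + b 6) (_hQ45 : b 0 < (p : ℤ) + b 4 + b 5) (_hQ37 : (p : ℤ) + b 3 + b 7 ≤ b 0) (_hQ46 : (p : ℤ) + b 4 + b 6 ≤ b 0) : dOf b < 2 * (p : ℤ) := by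
  obtain ⟨h21, h32, h43, h54, h65, h76⟩ := sorted7_chain hs
  rw [DecompositionWholeCone.dOf_expand]; linarith

/-- **`PathAccountingFirstPeriod`'s conclusion on this `N_p = 6` profile (short blocks `all (1,k), (2,k), and (3,4),(3,5),(3,6),(4,5)`), EVERY sorted `b`, every direction `j`, every depth**
(`C⋆ ≤ 9`; `d < 2p`; the node asks `-2` at `⌊d/p⌋ = 0` and `-1` at `⌊d/p⌋ = 1`). -/
theorem pathAccounting_profile6d (b : ℕ → ℤ) (j p : ℕ) (hb : InPolytope b) (hs : Sorted7 b) (hbj : InPolytope (shift b j))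
    (hj1 : 1 ≤ j) (hj7 : j ≤ 7) (hprime : p.Prime) (hp5 : 5 ≤ p) (hwin : (b 0 + 2 : ℤ) < (p : ℤ) ^ 2) (hfp : FirstPeriod b p)
    (hP : (p : ℤ) ≤ b 7) (hQ : b 0 < (p : ℤ) + b 2 + b 7) (hQ36 : b 0 < (p : ℤ) + b 3 + b 6) (hQ45 : b 0 < (p : ℤ) + b 4 + b 5) (hQ37 : (p : ℤ) + b 3 + b 7 ≤ b 0) (hQ46 : (p : ℤ) + b 4 + b 6 ≤ b 0)
    (hcas : casoratian b j ≠ 0) :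
    dOf b / (p : ℤ) - pairFloors b p - min (if 2 ≤ dOf b / (p : ℤ) then (1 : ℤ) else 0) (5 - (cStar b p : ℤ))
      ≤ padicValRat p (casoratian b j) := by
  obtain ⟨hF1, hF2⟩ := fp_bounds hfp
  have hp0 : (0 : ℤ) < p := by exact_mod_cast hprime.pos
  rw [pairFloors_eq_6d hb hs hprime.pos hQ hQ36 hQ45 hQ37 hQ46 hfp]
  have hC9 : (cStar b p : ℤ) ≤ 9 := by exact_mod_cast cStar_le_nine_6d hs hQ hQ36 hQ45
  have hfd : dOf b / (p : ℤ) < 2 := by rw [Int.ediv_lt_iff_lt_mul hp0]; linarith [d_lt_two6d hs hP hQ hQ36 hQ45 hQ37 hQ46]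
  rw [if_neg (by omega)]
  have hmin : -4 ≤ min (0 : ℤ) (5 - (cStar b p : ℤ)) := le_min (by norm_num) (by linarith)
  by_cases h1 : (p : ℤ) ≤ dOf b
  · linarith [cas_ge6d_neg1 hb hs hbj hj1 hj7 hprime hp5 hwin hP hQ hQ36 hQ45 hQ37 hQ46 hF1 hF2 h1 hcas]
  · push Not at h1
    obtain ⟨h21, h32, h43, h54, h65, h76⟩ := sorted7_chain hs
    have hsum := hb.2.2
    simp only [Finset.sum_range_succ, Finset.sum_range_zero, zero_add, Nat.reduceAdd] at hsum
    have hd0 : 0 ≤ dOf b := by rw [DecompositionWholeCone.dOf_expand]; linarith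
    have hfd0 : dOf b / (p : ℤ) = 0 := Int.ediv_eq_zero_of_lt hd0 h1
    rw [hfd0]
    linarith [cas_ge6d_neg2 hb hs hbj hj1 hj7 hprime hp5 hwin hP hQ hQ36 hQ45 hQ37 hQ46 hF1 hF2 hcas]

/-- **THE NODE ON THIS `N_p = 6` PROFILE, EVERY SORTED `b`, EVERY DEPTH: `PathAccountingFirstPeriod` with its binders VERBATIM plus `p ≤ b₇` and the profile
inequalities.** -/
theorem pathAccountingFirstPeriod_profile6d :
    ∀ (b : ℕ → ℤ) (p : ℕ), InPolytope b → Sorted7 b → InPolytope (shift b 7) →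
      p.Prime → 5 ≤ p → (b 0 + 2 : ℤ) < (p : ℤ) ^ 2 → FirstPeriod b p →
      (p : ℤ) ≤ b 7 → b 0 < (p : ℤ) + b 2 + b 7 → b 0 < (p : ℤ) + b 3 + b 6 → b 0 < (p : ℤ) + b 4 + b 5 → (p : ℤ) + b 3 + b 7 ≤ b 0 → (p : ℤ) + b 4 + b 6 ≤ b 0 → casoratian b 7 ≠ 0 →
        dOf b / (p : ℤ) - pairFloors b p - min (if 2 ≤ dOf b / (p : ℤ) then (1 : ℤ) else 0) (5 - (cStar b p : ℤ))
          ≤ padicValRat p (casoratian b 7) :=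
  fun b p hb hs hb7 hprime hp5 hwin hfp hP hQ hQ36 hQ45 hQ37 hQ46 hcas =>
    pathAccounting_profile6d b 7 p hb hs hb7 (by norm_num) (by norm_num) hprime hp5 hwin hfp hP hQ hQ36 hQ45 hQ37 hQ46 hcas

end P6D

end Summit.KontsevichZagierPeriods.Zeta5Search.FullProfile
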